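import Literature.MathematicalPhysics.QuantumFieldTheory.Balaban1983to89.B9Thm313WholeLeafCompletePairMBCZcUSXC

/-!
# `Balaban1983to89.B9Thm313WholeLeafCompletePairMBCZcUSXCL` — [B9] Theorem 3.13 (p. 426): the ROW-21 S-LEAF `…MBCZcUSXC` with the block-L² pair record `hLL2` taken
# WITHOUT its `c1` field (the pair letters as a FUNCTION of `c1`, monotone in the letters) and the `c1` field — (3.46) for C₁ = (QG₁Q\*)⁻¹ — at ITS OWN letters `(BC, δC)`

T. Bałaban, *Propagators for lattice gauge theories in a background field*, Commun. Math. Phys. **99** (1985) 389–434 [`Balaban1985BackgroundPropagators`, "B9"];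
[4] = T. Bałaban, *Propagators and renormalization transformations for lattice gauge theories. II*, Commun. Math. Phys. **96** (1984) 223–250 [`Balaban1984PropagatorsII`].

statement-level skeleton of published theorems with citation tags; proofs where landed; nothing here is a claim about the Yang–Mills mass gap

WHY THIS FILE (cell `pub-ymgap`, node N06, bundle F7 rows 20–21, seat dag-n06-l g32; dag-n06-d's LOCATED-c1, fleet bus I.31307).  The N06 certificate DERIVES the (3.132)
sup-class letter of C₁ inside the rows-20–21 face (`…N06ZLettersLegAtPinsPU.zletters_of_pins`, conjunct 5, from its own ROW 26) at row 26's PRODUCED rate `δC` and in the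
face's INNER regime, and dag-n06-c's `…N06C1L2LegAtPinsR.c1L2_of_pinsR` turns it into the block-L² field `Letters313L2Pc.c1` (Schur + the counting self-transpose of
`C1coK`) — at `(Bz, δC)`, NOT at the certificate's displayed `(B13₄, δ12₃)`: so the displayed `hc1L2` cannot be folded at the certificate level, only INSIDE the face, and
the face's leaf must accept `c1` at a rate of its own.  The landed S-leaf `thm313Printed_completePairMBCZcUSXC` weakens the whole record `hLL2` to its master rate
`ρ ≤ δ₃` at once (`letters313L2Pc_mono ∕ letters313L2MZ_mono`), so nothing in its proof needs `c1` faster than `ρ`.  THIS TWIN states `hLL2`.1 as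
`∀ B′ δ′, B₄ ≤ B′ → δ′ ≤ δ₃ → (c1 at (B′, δ′)) → Letters313L2Pc … B′ δ′ …` (the ten OTHER fields, monotone in the letters — a consumer holding them at `(B₄, δ₃)`
discharges it by this file's `letters313L2Pc_of_fields`), adds `hc1L2` at `(BC, δC)` (any real `BC`; `ρ ≤ δC` is already the leaf's `hρC`), and proves the printed
conclusion by ONE call of the leaf at `(B₄ := max B₄ BC, δ₃ := ρ)` with every δ₃-family weakened to ρ exactly as the leaf does inside; EVERYTHING ELSE IS THE LEAF'S
STATEMENT VERBATIM (constants, readings, state layers, conclusion `B9.Thm313Printed …`).  §1 carries the two bookkeeping lemmas (`letters313L2MZ_monoB`: the direction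
letters at weaker letters `B₄ ≤ B₄′, δ′ ≤ δ`; `letters313L2Pc_of_fields`: the function form from the ten fields).  Generator `work/g32/mkUSXCL.py` over the tree leaf.
HONEST SCOPE.  Bookkeeping (monotonicity of majorants in their letters) over the landed leaf; every analytic member stays a HYPOTHESIS of printed species; COUNT-NEUTRAL;
N06 NOT discharged; nothing continuum ∕ OS positivity ∕ mass gap.  NEW file; the leaf `…MBCZcUSXC` untouched.
-/

namespace Literature.MathematicalPhysics.QuantumFieldTheory.Balaban1983to89.B9Thm313WholeLeafCompletePairMBCZcUSXCL

open Finset B6RandomWalk B6RandomWalkHom B9Thm34Ext B9Thm37GlueCor36 B11SectG B9SectDSup B9Thm37AllNorms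
open B9Thm37AllNormsInstances B9FromB6 B9FromB6ModelSignsOn B9SectBStepWhole B9Thm312Whole B9Thm312WholeLeaf B9Thm312WholeLeft B9Thm313Whole
open B9Thm313WholeLeft B9Thm312WholeLeafLeftGlob B9Ineq347CoReading B9SectCDiffDict B9CoRealizesRel B9Thm37Glue B9SectDL2Decay B9RWSums343Holder
open B9RWSumsReadsRel B9RWSumsReadsNbr B9Ineq347 B9Thm312WholeClasses B9Thm312WholeL2 B9Thm312WholeBlocksRel B9Thm312WholeBlocksNbr B9Thm313WholeLeafRel
open B9Thm312WholeHolder B9Thm312WholeHHolder B9Thm313WholeHolder B9Thm313WholeL2G B9Thm313WholeL2GP B9Thm313WholeInput B9Thm313WholeBlocksNbr B9Thm312WholeLeafAll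
open B9RWSums346SecondDiff B9Thm313WholeBlocksNbrRec B9RWSums344InputFam B9Thm312WholeDir B9Thm312WholeBlocksPairM B9Thm313WholeDir B9Thm313WholeDirInput B9Thm313WholeBlocksPairM
open B9Thm313WholeLeafCompletePairM B9Thm312WholeDirB B9Thm313WholeDirInputB B9Thm313WholeBlocksPairMB B9Thm313WholeLeafCompletePairMB B9Thm313WholeBlocksPairMZ B9Thm313WholeBlocksPairMBZ B9Thm313WholeLeafRelZ
open B9Thm313WholeLeafCompletePairMBZ B9Thm313WholeDirInputBC B9Thm313WholeBlocksPairMBCZ B9Thm313WholeLeafCompletePairMBCZ B9Thm313WholeRgdFrom3152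
open B9Thm313WholeLettersCut B9Thm313WholeCutCores B9Thm313WholeLeafRelZCut B9Thm313WholeLeafRelZCutU B9Thm313WholeBlocksPairMZCut B9Thm313WholeBlocksPairMBCZCut
open B9Thm312WholeHZ B9Thm313WholeZ B9Thm313WholeLeftZ B9Thm313WholeHolderZ B9Thm313WholeInputZ B9Thm313WholeDirZ B9Thm313WholeDirInputZ B9Thm313WholeDirInputBZ
open B9Thm313WholeL2GZ B9Thm313WholeL2GPZ B9Thm313WholeDirL2Z B9Thm313WholeLeafCompletePairMBCZCutU B9Thm313WholeLeafRelZCutUE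
open B9Thm312WholeStepRegular B9Thm312WholeSeriesRegular B9Thm313WholeGGBlocksRegular B9Thm313WholeGGBlocksRegularT
open B9Thm313WholeGXHRegular B9LettersZSchemasMono
open B9Thm313WholeLeafCompletePairMBCZcUSXC

noncomputable section

/-! ## §1 Bookkeeping: the block-L² records at weaker letters; the pair record as a function of its `c1` field -/

section L2Mono

variable {g : B9.Geometry} {B : B9.Backgrounds} {X Y Z W P : Type} [Fintype X] [Fintype Y] [Fintype Z] [Fintype W] [Fintype g.Site]
variable {R₀ : ℝ} {H₀ : Prop}

omit [Fintype Y] in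
/-- the direction-indexed block-L² letters at weaker letters (`B₄ ≤ B₄′`, `δ′ ≤ δ`, d ≧ 0) — `letters313L2MZ_mono` with the constant moved as well.
[cite: Balaban1985BackgroundPropagators, (3.46) p.398 (bookkeeping)] -/
theorem letters313L2MZ_monoB {𝔬 : Ops g B X Y Z W} {Dd Dds : B.Cfg → P → Module.End ℝ (X → ℝ)} {B₄ B₄' δ δ' : ℝ} {U : B.Cfg}
    (hG : GeoOK g) (hB₄ : 0 ≤ B₄) (hBB : B₄ ≤ B₄') (hδ : δ' ≤ δ) {vZ : g.Site → ℝ} {hvZ : ∀ y, 0 < vZ y}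
    (h : Letters313L2MZ 𝔬 Dd Dds R₀ H₀ B₄ δ vZ hvZ U) : Letters313L2MZ 𝔬 Dd Dds R₀ H₀ B₄' δ' vZ hvZ U := by
  have hexp : ∀ y y' : g.Site, Real.exp (-(δ * g.dist y y')) ≤ Real.exp (-(δ' * g.dist y y')) := fun y y' =>
    Real.exp_le_exp.mpr (neg_le_neg (mul_le_mul_of_nonneg_right hδ (hG.dnn y y')))
  have hB' : 0 ≤ B₄' := hB₄.trans hBB
  have k0 : ∀ y y' : g.Site, B₄ * Real.exp (-(δ * g.dist y y')) ≤ B₄' * Real.exp (-(δ' * g.dist y y')) := fun y y' =>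
    mul_le_mul hBB (hexp y y') (Real.exp_nonneg _) hB'
  have kw : ∀ {w : ℝ}, 0 ≤ w → ∀ y y' : g.Site, B₄ * w * Real.exp (-(δ * g.dist y y')) ≤ B₄' * w * Real.exp (-(δ' * g.dist y y')) :=
    fun hw y y' => mul_le_mul (mul_le_mul_of_nonneg_right hBB hw) (hexp y y') (Real.exp_nonneg _) (mul_nonneg hB' hw)
  exact
    { dGDvd := fun ν => (h.dGDvd ν).mono fun y y' => k0 y y'
      dGQsd := fun ν => (h.dGQsd ν).mono fun y y' => kw (mul_nonneg (hvZ y').le (hG.lenle y')) y y'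
      rgdDd := fun μ => (h.rgdDd μ).mono fun y y' => k0 y y' }

/-- ★ the re-cut block-L² pair record AS A FUNCTION OF ITS `c1` FIELD, from its ten other fields at `(B₄, δ)`: for every `B′ ≧ B₄`, `δ′ ≦ δ` and every `c1` field at
`(B′, δ′)`, the record at `(B′, δ′)` (the ten fields weakened: e^{−δd} ≦ e^{−δ′d}, B₄ ≦ B′) — the shape in which `thm313Printed_completePairMBCZcUSXCL` takes `hLL2`.1,
so that a certificate displaying the ten fields and DERIVING `c1` elsewhere (at other letters) discharges it in one term.
[cite: Balaban1985BackgroundPropagators, (3.46) p.398 + Thm 3.13 p.426 (bookkeeping)] -/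
theorem letters313L2Pc_of_fields {𝔬 : Ops g B X Y Z W} {Dd Dds : B.Cfg → P → Module.End ℝ (X → ℝ)} {B₄ δ : ℝ} {U : B.Cfg}
    (hG : GeoOK g) (hB₄ : 0 ≤ B₄) {vZ : g.Site → ℝ} {hvZ : ∀ y, 0 < vZ y}
    (gDv : BlockBd (g := toB6 g R₀ H₀) 𝔬.blkW 𝔬.blk (𝔬.G0 U ∘ₗ 𝔬.Dv U)
      (fun (y y' : g.Site) => B₄ * g.len y * Real.exp (-(δ * g.dist y y'))))
    (dGDv : BlockBd (g := toB6 g R₀ H₀) 𝔬.blkW 𝔬.blkY (𝔬.D U ∘ₗ 𝔬.G0 U ∘ₗ 𝔬.Dv U)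
      (fun (y y' : g.Site) => B₄ * Real.exp (-(δ * g.dist y y'))))
    (gQs : BlockBd (g := toB6 g R₀ H₀) 𝔬.blkZ 𝔬.blk (𝔬.G0 U ∘ₗ 𝔬.Qstar U)
      (fun (y y' : g.Site) => B₄ * g.len y * (vZ y' * g.len y') * Real.exp (-(δ * g.dist y y'))))
    (ddGQs : ∀ q : P × P, BlockBd (g := toB6 g R₀ H₀) 𝔬.blkZ 𝔬.blk ((Dd U q.1 ∘ₗ Dd U q.2) ∘ₗ 𝔬.G0 U ∘ₗ 𝔬.Qstar U)
      (fun (y y' : g.Site) => B₄ * ((g.len y)⁻¹ * (vZ y' * g.len y')) * Real.exp (-(δ * g.dist y y'))))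
    (dGQs : BlockBd (g := toB6 g R₀ H₀) 𝔬.blkZ 𝔬.blkY (𝔬.D U ∘ₗ 𝔬.G0 U ∘ₗ 𝔬.Qstar U)
      (fun (y y' : g.Site) => B₄ * (vZ y' * g.len y') * Real.exp (-(δ * g.dist y y'))))
    (rgdI : BlockBd (g := toB6 g R₀ H₀) 𝔬.blk 𝔬.blkW (𝔬.R U ∘ₗ 𝔬.Dvstar U ∘ₗ 𝔬.G1 U ∘ₗ LinearMap.id)
      (fun (y y' : g.Site) => B₄ * g.len y' * Real.exp (-(δ * g.dist y y'))))
    (rgdDs : BlockBd (g := toB6 g R₀ H₀) 𝔬.blkY 𝔬.blkW (𝔬.R U ∘ₗ 𝔬.Dvstar U ∘ₗ 𝔬.G1 U ∘ₗ 𝔬.Dstar U)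
      (fun (y y' : g.Site) => B₄ * Real.exp (-(δ * g.dist y y'))))
    (q : BlockBd (g := toB6 g R₀ H₀) 𝔬.blk 𝔬.blkZ (𝔬.Q U)
      (fun (y y' : g.Site) => B₄ * (vZ y * g.len y * (g.len y')⁻¹) * Real.exp (-(δ * g.dist y y'))))
    (vDRDG : BlockBd (g := toB6 g R₀ H₀) 𝔬.blk 𝔬.blk (𝔬.Dv U ∘ₗ 𝔬.R U ∘ₗ 𝔬.Dvstar U ∘ₗ 𝔬.G1 U)
      (fun (y y' : g.Site) => B₄ * ((g.len y)⁻¹ * g.len y') * Real.exp (-(δ * g.dist y y'))))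
    (vGDRD : BlockBd (g := toB6 g R₀ H₀) 𝔬.blk 𝔬.blk (𝔬.G1 U ∘ₗ 𝔬.Dv U ∘ₗ 𝔬.R U ∘ₗ 𝔬.Dvstar U)
      (fun (y y' : g.Site) => B₄ * (g.len y * (g.len y')⁻¹) * Real.exp (-(δ * g.dist y y')))) :
    ∀ B' δ' : ℝ, B₄ ≤ B' → δ' ≤ δ →
      BlockBd (g := toB6 g R₀ H₀) 𝔬.blkZ 𝔬.blkZ (𝔬.C1 U)
        (fun (y y' : g.Site) => B' * (vZ y * g.len y)⁻¹ * (vZ y' * g.len y')⁻¹ * Real.exp (-(δ' * g.dist y y'))) →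
      Letters313L2Pc 𝔬 Dd Dds R₀ H₀ B' δ' vZ hvZ U := by
  intro B' δ' hBB hδ c1
  have hexp : ∀ y y' : g.Site, Real.exp (-(δ * g.dist y y')) ≤ Real.exp (-(δ' * g.dist y y')) := fun y y' =>
    Real.exp_le_exp.mpr (neg_le_neg (mul_le_mul_of_nonneg_right hδ (hG.dnn y y')))
  have hB' : 0 ≤ B' := hB₄.trans hBB
  have hl : ∀ y : g.Site, 0 ≤ g.len y := hG.lenle
  have hli : ∀ y : g.Site, 0 ≤ (g.len y)⁻¹ := fun y => inv_nonneg.mpr (hl y)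
  have hv : ∀ y : g.Site, 0 ≤ vZ y * g.len y := fun y => (mul_pos (hvZ y) (hG.lenpos y)).le
  have k0 : ∀ y y' : g.Site, B₄ * Real.exp (-(δ * g.dist y y')) ≤ B' * Real.exp (-(δ' * g.dist y y')) := fun y y' =>
    mul_le_mul hBB (hexp y y') (Real.exp_nonneg _) hB'
  have kw : ∀ {w : ℝ}, 0 ≤ w → ∀ y y' : g.Site, B₄ * w * Real.exp (-(δ * g.dist y y')) ≤ B' * w * Real.exp (-(δ' * g.dist y y')) :=
    fun hw y y' => mul_le_mul (mul_le_mul_of_nonneg_right hBB hw) (hexp y y') (Real.exp_nonneg _) (mul_nonneg hB' hw)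
  exact
    { gDv := gDv.mono fun y y' => kw (hl y) y y'
      dGDv := dGDv.mono fun y y' => k0 y y'
      gQs := gQs.mono fun y y' => mul_le_mul (mul_le_mul_of_nonneg_right (mul_le_mul_of_nonneg_right hBB (hl y)) (hv y')) (hexp y y')
        (Real.exp_nonneg _) (mul_nonneg (mul_nonneg hB' (hl y)) (hv y'))
      ddGQs := fun q' => (ddGQs q').mono fun y y' => kw (mul_nonneg (hli y) (hv y')) y y'
      dGQs := dGQs.mono fun y y' => kw (hv y') y y'
      rgdI := rgdI.mono fun y y' => kw (hl y') y y'
      rgdDs := rgdDs.mono fun y y' => k0 y y'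
      c1 := c1
      q := q.mono fun y y' => kw (mul_nonneg (hv y) (hli y')) y y'
      vDRDG := vDRDG.mono fun y y' => kw (mul_nonneg (hli y) (hl y')) y y'
      vGDRD := vGDRD.mono fun y y' => kw (mul_nonneg (hl y) (hli y')) y y' }

end L2Mono

section Family

variable {I : Type} {c35 : ℝ} {geo : I → B9.Geometry} {bg : I → B9.Backgrounds}
variable [∀ i, Fintype (geo i).Site] [∀ i, DecidableEq (geo i).Site]
variable {X Y Z W PX PY : I → Type} {P : Type} [∀ i, Fintype (X i)] [∀ i, DecidableEq (X i)] [∀ i, Fintype (Y i)]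
  [∀ i, Fintype (Z i)] [∀ i, Fintype (W i)] [∀ i, Fintype (PX i)] [∀ i, Fintype (PY i)] [Fintype P]

set_option maxHeartbeats 1600000 in
/-- ★★★ **THEOREM 3.13 AS PRINTED, PAIR-MBCZc SPECIES, OVER THE REGULAR STATE, Z-LETTERS FIELD-WISE WITH THE (3.132) LETTERS AT THEIR OWN RATE `δC`, THE BLOCK-L² PAIR
RECORD AS A FUNCTION OF ITS `c1` FIELD AND `c1` AT ITS OWN LETTERS `(BC, δC)`** — this file's module docstring; otherwise the leaf `thm313Printed_completePairMBCZcUSXC`'s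
text (its docstring applies word for word: output constants the displayed polynomials of `GG_blocks_of_stateST` at the uniform inputs, here at the cut constant `max B₄ BC`).
[cite: Balaban1985BackgroundPropagators, Thm 3.13 p.426 + Thm 3.12 pp.421–423 + (3.39)–(3.47) pp.397–398 + (3.126) p.420 + (3.132) p.422 + (3.152)–(3.153) p.426; Balaban1984PropagatorsII, (2.51)–(2.56) pp.232–233 + Lemma 2.1 (2.60)–(2.61) p.234 + (2.66) p.234] -/
theorem thm313Printed_completePairMBCZcUSXCL (𝔬 : ∀ i, Ops (geo i) (bg i) (X i) (Y i) (Z i) (W i)) (R₀ : I → ℝ) (H₀ : I → Prop)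
    (GG : ∀ i, B9.KernelFamily (geo i) (bg i)) (bH : ∀ i, (bg i).Cfg → BlockNorm (toB6 (geo i) (R₀ i) (H₀ i)) (W i → ℝ))
    (𝔭 : ∀ i, HolderProbes (geo i) (bg i) (X i) (Y i) (PX i) (PY i))
    (bHX : ∀ i, ℝ → BlockNorm (toB6 (geo i) (R₀ i) (H₀ i)) (X i → ℝ))
    (Gp : ∀ i, (bg i).Cfg → Module.End ℝ (W i → ℝ)) (bXH : ∀ i, (bg i).Cfg → BlockNorm (toB6 (geo i) (R₀ i) (H₀ i)) (X i → ℝ))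
    (Dd Dds : ∀ i, (bg i).Cfg → P → Module.End ℝ (X i → ℝ))
    (bHW : ∀ i, (bg i).Cfg → ℝ → BlockNorm (toB6 (geo i) (R₀ i) (H₀ i)) (W i → ℝ))
    (𝔖₂ 𝔖₁ : ∀ i, (bg i).Cfg → BlockNorm (toB6 (geo i) (R₀ i) (H₀ i)) (X i → ℝ))
    (ev : ∀ i, (geo i).Loc → X i → ℝ) (evY : ∀ i, (geo i).Loc → Y i → ℝ) {PL : ∀ i, (geo i).Loc → Prop}
    (Rel : ∀ i, (geo i).Site → (geo i).Site → Prop) [∀ i, DecidableRel (Rel i)] (m mN : ℕ)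
    (r Cev CL θS θD θ₂ r₁ B₀ B₂ B₄ BC δ₀ δK δP σ c ρ a₁ M₁ ML B₃ δ₃ δC ρ' α Lc κ₀ κS A₀ AW AQ AD AQ1 CR CR₁ : ℝ)
    (Bh Bi Bq BhD Bx Bd θH Br AI AV : ℝ → ℝ) (Bi2 Bd2 : ℝ → ℝ → ℝ)
    (hθS : 0 ≤ θS) (hθD : 0 ≤ θD) (hθH : ∀ β, 0 ≤ β → β < 1 → 0 ≤ θH β) (hθ₂ : 0 ≤ θ₂)
    (hκS : 1 ≤ κS) (hA₀ : 0 ≤ A₀) (hAW : 0 ≤ AW) (hAQ : 0 ≤ AQ) (hAD : 0 ≤ AD) (hAQ1 : 0 ≤ AQ1) (hCR : 0 ≤ CR) (hCR₁ : 0 ≤ CR₁)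
    (hAI : ∀ ε, 0 < ε → 0 ≤ AI ε) (hAV : ∀ ε, 0 < ε → 0 ≤ AV ε)
    (hr₁ : 0 ≤ r₁) (hB₀ : 0 ≤ B₀) (hB₂ : 0 ≤ B₂)
    (hB₃ : 0 ≤ B₃) (hB₄ : 0 ≤ B₄) (hBr : ∀ ε, 0 < ε → 0 ≤ Br ε) (hσ : 0 ≤ σ) (hρ' : 0 < ρ') (hρ'ρ : ρ' + 3 * σ ≤ ρ) (hρ'ρ₅ : ρ' + 5 * σ ≤ ρ)
    (hσρ' : 3 * σ < (1 - α) * ρ')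
    (hρS : ρ ≤ δ₀) (hρ₃ : ρ ≤ δ₃) (hρC : ρ ≤ δC) (hρδ : ρ + 2 * σ ≤ δK) (hρP : ρ + 2 * σ ≤ δP) (hc : 0 ≤ c) (ha₁ : 0 < a₁) (hM₁ : 0 < M₁)
    (hα0 : 0 ≤ α) (hBi : ∀ ε, 0 < ε → ε ≤ 1 → 0 ≤ Bi ε) (hBd : ∀ ε, 0 < ε → ε ≤ 1 → 0 ≤ Bd ε)
    (hBi2 : ∀ ε β, 0 < ε → ε ≤ 1 → 0 ≤ β → β < 1 → 0 ≤ Bi2 ε β) (hBd2 : ∀ ε β, 0 < ε → ε ≤ 1 → 0 ≤ β → β < 1 → 0 ≤ Bd2 ε β)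
    (hBh : ∀ β, 0 ≤ β → β < 1 → 0 ≤ Bh β) (hBq : ∀ β, 0 ≤ β → β < 1 → 0 ≤ Bq β) (hBhD : ∀ β, 0 ≤ β → β < 1 → 0 ≤ BhD β)
    (hBx : ∀ β, 0 ≤ β → β < 1 → 0 ≤ Bx β) (hCev : 0 ≤ Cev) (hCL1 : 1 ≤ CL)
    (hgeo : ∀ i, GeoOK (geo i)) (S : ∀ i, ModelSignsOn (geo i) (PL i))
    (hL1 : ∀ i, 1 ≤ (geo i).L) (hLle : ∀ i, (geo i).L ≤ Lc) (hη : ∀ i, 0 < (geo i).eta) (hκ : ∀ (i : I) (U : (bg i).Cfg), (bH i U).κ ≤ κ₀)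
    (hκW : ∀ (i : I) (U : (bg i).Cfg) (ε : ℝ), (bHW i U ε).κ ≤ κ₀) (hκX : ∀ (i : I) (U : (bg i).Cfg), (bXH i U).κ ≤ κ₀)
    (hκ2 : ∀ (i : I) (U : (bg i).Cfg), (𝔖₂ i U).κ ≤ κS) (hκ1 : ∀ (i : I) (U : (bg i).Cfg), (𝔖₁ i U).κ ≤ κS)
    -- 𝔖₁ IS the bond Hölder class bXH (the pin; `rfl` at the certificate) and the budget of the DERIVED G₁∇\*_U INTO bXH (constant 2·A_D)
    (hSX : ∀ (i : I) (U : (bg i).Cfg), 𝔖₁ i U = bXH i U) (hADB : 2 * AD ≤ B₃)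
    (hrow : ∀ i, ML ≤ (geo i).M → RowSum (toB6 (geo i) (R₀ i) (H₀ i)) σ c)
    (hL21 : ∀ δ : ℝ, 0 < δ → ∃ ML' c' : ℝ, Lemma21AboveG geo R₀ H₀ δ α ML' c')
    (hnbr : ∀ (i : I) (y : (geo i).Site), (nbr (geo i) r y).card ≤ mN)
    (hCL : ∀ (i : I) (a a' : (geo i).Site), (geo i).dist a a' ≤ r → (geo i).len a ≤ CL * (geo i).len a')
    (hsat : ∀ (i : I) (n : Fin 4) (B' δ' : ℝ),
      (∀ a a' b, Rel i a a' → maj342 (geo i) n B' δ' a b = maj342 (geo i) n B' δ' a' b) ∧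
      (∀ a b b', Rel i b b' → maj342 (geo i) n B' δ' a b = maj342 (geo i) n B' δ' a b'))
    (hmult : ∀ (i : I) (y' : (geo i).Site), (Finset.univ.filter (fun y'' => Rel i y'' y')).card ≤ m)
    (hcoR : ∀ (i : I) (U : (bg i).Cfg),
      CoRealizesRel (GG i) 0 U (Rel i) (𝔬 i).blk (𝔬 i).blk (ev i) ((𝔬 i).GG U) ∧
      CoRealizesRel (GG i) 2 U (Rel i) (𝔬 i).blk (𝔬 i).blkY (evY i) ((𝔬 i).GG U ∘ₗ (𝔬 i).Dstar U))
    (hco1R : ∀ (i : I) (U : (bg i).Cfg), CoRealizesRel (GG i) 1 U (Rel i) (𝔬 i).blkY (𝔬 i).blk (ev i) ((𝔬 i).D U ∘ₗ (𝔬 i).GG U))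
    (hcoG : ∀ (i : I) (U : (bg i).Cfg),
      CoReadsGlob (GG i) 0 U (𝔬 i).blk (𝔬 i).blk (ev i) ((𝔬 i).GG U) ∧
      CoReadsGlob (GG i) 1 U (𝔬 i).blkY (𝔬 i).blk (ev i) ((𝔬 i).D U ∘ₗ (𝔬 i).GG U) ∧
      CoReadsGlob (GG i) 2 U (𝔬 i).blk (𝔬 i).blkY (evY i) ((𝔬 i).GG U ∘ₗ (𝔬 i).Dstar U))
    (hsymGG : ∀ i, M₁ ≤ (geo i).M → ∀ α₀ : ℝ, 0 < α₀ → (geo i).M * α₀ ≤ a₁ →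
      ∀ U : (bg i).Cfg, (bg i).Reg335 c35 α₀ U → (bg i).Reg336 c35 α₀ U →
        IsTransposePair ((𝔬 i).GG U) ((𝔬 i).GG U) ∧ IsTransposePair ((𝔬 i).D U ∘ₗ (𝔬 i).GG U) ((𝔬 i).GG U ∘ₗ (𝔬 i).Dstar U))
    (hl2N : ∀ (i : I) (U : (bg i).Cfg),
      L2ReadsNbr (R := R₀ i) (H := H₀ i) (GG i) 0 U (Rel i) r Cev (𝔬 i).blk (𝔬 i).blk (ev i) ((𝔬 i).GG U) ∧
      L2ReadsNbr (R := R₀ i) (H := H₀ i) (GG i) 1 U (Rel i) r Cev (𝔬 i).blkY (𝔬 i).blk (ev i) ((𝔬 i).D U ∘ₗ (𝔬 i).GG U) ∧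
      L2ReadsNbr (R := R₀ i) (H := H₀ i) (GG i) 2 U (Rel i) r Cev (𝔬 i).blk (𝔬 i).blkY (evY i) ((𝔬 i).GG U ∘ₗ (𝔬 i).Dstar U) ∧
      L2ReadsNbr (R := R₀ i) (H := H₀ i) (GG i) 3 U (Rel i) r Cev ((𝔬 i).blk ∘ Prod.fst) (𝔬 i).blk (ev i)
        (familyOp (fun q : P × P => Dd i U q.1 ∘ₗ ((𝔬 i).GG U ∘ₗ Dds i U q.2))) ∧
      L2ReadsNbr (R := R₀ i) (H := H₀ i) (GG i) 4 U (Rel i) r Cev ((𝔬 i).blk ∘ Prod.fst) (𝔬 i).blk (ev i)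
        (familyOp (fun q : P × P => (Dd i U q.1 ∘ₗ Dd i U q.2) ∘ₗ (𝔬 i).GG U)) ∧
      L2ReadsNbr (R := R₀ i) (H := H₀ i) (GG i) 5 U (Rel i) r Cev ((𝔬 i).blk ∘ Prod.fst) (𝔬 i).blk (ev i)
        (familyOp (fun q : P × P => (𝔬 i).GG U ∘ₗ (Dds i U q.1 ∘ₗ Dds i U q.2))))
    (hH1N : ∀ (i : I) (U : (bg i).Cfg),
      H1ReadsNbr (GG i) U (𝔭 i) (Rel i) r (𝔬 i).blk (𝔬 i).blkY (ev i) (evY i) ((𝔬 i).D U ∘ₗ (𝔬 i).GG U)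
        ((𝔬 i).GG U ∘ₗ (𝔬 i).Dstar U))
    (hIF : ∀ (i : I) (U : (bg i).Cfg),
      InputReadsFam (GG i) U (bHX i) r ((𝔬 i).blk ∘ Prod.fst) ((𝔭 i).blkPX ∘ Prod.fst) (fun β => sliceProbe ((𝔭 i).ΦX U β)) (ev i)
        (familyOp (fun q : P × P => Dd i U q.1 ∘ₗ ((𝔬 i).GG U ∘ₗ Dds i U q.2))))
    (hRdist : ∀ (i : I) (a a' b : (geo i).Site), Rel i a a' → (geo i).dist a b = (geo i).dist a' b)
    (hmodel : ∀ i, M₁ ≤ (geo i).M → ∀ α₀ : ℝ, 0 < α₀ → (geo i).M * α₀ ≤ a₁ →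
      ∀ U : (bg i).Cfg, (bg i).Reg335 c35 α₀ U → (bg i).Reg336 c35 α₀ U →
        FormSmall (𝔬 i) (r₁ * ((geo i).M * α₀)) U ∧ Identities (𝔬 i) U)
    (he1 : ∀ i, M₁ ≤ (geo i).M → ∀ α₀ : ℝ, 0 < α₀ → (geo i).M * α₀ ≤ a₁ →
      ∀ U : (bg i).Cfg, (bg i).Reg335 c35 α₀ U → (bg i).Reg336 c35 α₀ U →
        HasMajorantHom (g := toB6 (geo i) (R₀ i) (H₀ i)) (𝔬 i).blk (𝔬 i).blkY ((𝔬 i).D U ∘ₗ (𝔬 i).G0 U)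
          (fun (a b : (geo i).Site) => B₀ * (geo i).len a * Real.exp (-(δ₀ * (geo i).dist a b))))
    (wZ : ∀ i, (geo i).Site → ℝ) (hwZ : ∀ i y, 0 < wZ i y)
    -- the EIGHT bXH-free letters of Theorem 3.13's reduction FIELD-WISE (the certificate's display `hZ8` verbatim: gD2 gQs2 gQs1 rgd2 c1_2 c1_1 q2 q1 at B₃ δ₃)
    (hZ8 : ∀ i, M₁ ≤ (geo i).M → ∀ α₀ : ℝ, 0 < α₀ → (geo i).M * α₀ ≤ a₁ →
      ∀ U : (bg i).Cfg, (bg i).Reg335 c35 α₀ U → (bg i).Reg336 c35 α₀ U →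
        HasMaj (cNorm (R₀ i) (H₀ i) (𝔬 i).blkW (hgeo i).lenle 1) (cNorm (R₀ i) (H₀ i) (𝔬 i).blk (hgeo i).lenle 2) ((𝔬 i).G0 U ∘ₗ (𝔬 i).Dv U) (fun a b => B₃ * Real.exp (-(δ₃ * (geo i).dist a b))) ∧
        HasMaj (weightNorm (BlockNorm.ofBlocks (toB6 (geo i) (R₀ i) (H₀ i)) (𝔬 i).blkZ) (wZ i) fun y => (hwZ i y).le) (cNorm (R₀ i) (H₀ i) (𝔬 i).blk (hgeo i).lenle 2) ((𝔬 i).G0 U ∘ₗ (𝔬 i).Qstar U) (fun a b => B₃ * Real.exp (-(δ₃ * (geo i).dist a b))) ∧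
        HasMaj (weightNorm (BlockNorm.ofBlocks (toB6 (geo i) (R₀ i) (H₀ i)) (𝔬 i).blkZ) (fun y => (geo i).len y * wZ i y) fun y => (wZlen_pos (hgeo i) (hwZ i) y).le) (cNorm (R₀ i) (H₀ i) (𝔬 i).blk (hgeo i).lenle 1) ((𝔬 i).G0 U ∘ₗ (𝔬 i).Qstar U) (fun a b => B₃ * Real.exp (-(δ₃ * (geo i).dist a b))) ∧
        HasMaj (cNorm (R₀ i) (H₀ i) (𝔬 i).blk (hgeo i).lenle 0) (cNorm (R₀ i) (H₀ i) (𝔬 i).blkW (hgeo i).lenle 1) ((𝔬 i).R U ∘ₗ (𝔬 i).Dvstar U ∘ₗ (𝔬 i).G1 U ∘ₗ LinearMap.id) (fun a b => B₃ * Real.exp (-(δ₃ * (geo i).dist a b))) ∧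
        HasMaj (cNorm (R₀ i) (H₀ i) (𝔬 i).blkZ (hgeo i).lenle 2) (weightNorm (BlockNorm.ofBlocks (toB6 (geo i) (R₀ i) (H₀ i)) (𝔬 i).blkZ) (wZ i) fun y => (hwZ i y).le) ((𝔬 i).C1 U) (fun a b => B₃ * Real.exp (-(δC * (geo i).dist a b))) ∧
        HasMaj (cNorm (R₀ i) (H₀ i) (𝔬 i).blkZ (hgeo i).lenle 1) (weightNorm (BlockNorm.ofBlocks (toB6 (geo i) (R₀ i) (H₀ i)) (𝔬 i).blkZ) (fun y => (geo i).len y * wZ i y) fun y => (wZlen_pos (hgeo i) (hwZ i) y).le) ((𝔬 i).C1 U) (fun a b => B₃ * Real.exp (-(δC * (geo i).dist a b))) ∧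
        HasMaj (cNorm (R₀ i) (H₀ i) (𝔬 i).blk (hgeo i).lenle 2) (cNorm (R₀ i) (H₀ i) (𝔬 i).blkZ (hgeo i).lenle 2) ((𝔬 i).Q U) (fun a b => B₃ * Real.exp (-(δ₃ * (geo i).dist a b))) ∧
        HasMaj (cNorm (R₀ i) (H₀ i) (𝔬 i).blk (hgeo i).lenle 1) (cNorm (R₀ i) (H₀ i) (𝔬 i).blkZ (hgeo i).lenle 1) ((𝔬 i).Q U) (fun a b => B₃ * Real.exp (-(δ₃ * (geo i).dist a b))))
    -- the (3.44) member of ∇_UG′R∇\*_U out of bXH (the certificate's derived `wGp`)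
    (hwGp : ∀ i, M₁ ≤ (geo i).M → ∀ α₀ : ℝ, 0 < α₀ → (geo i).M * α₀ ≤ a₁ →
      ∀ U : (bg i).Cfg, (bg i).Reg335 c35 α₀ U → (bg i).Reg336 c35 α₀ U →
        HasMaj (bXH i U) (cNorm (R₀ i) (H₀ i) (𝔬 i).blk (hgeo i).lenle 1) ((𝔬 i).Dv U ∘ₗ Gp i U ∘ₗ (𝔬 i).R U ∘ₗ (𝔬 i).Dvstar U) (fun a b => B₃ * Real.exp (-(δ₃ * (geo i).dist a b))))
    (h152 : ∀ i, M₁ ≤ (geo i).M → ∀ α₀ : ℝ, 0 < α₀ → (geo i).M * α₀ ≤ a₁ →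
      ∀ U : (bg i).Cfg, (bg i).Reg335 c35 α₀ U → (bg i).Reg336 c35 α₀ U → Ids3152 (𝔬 i) (Gp i) U)
    (hlettersD : ∀ i, M₁ ≤ (geo i).M → ∀ α₀ : ℝ, 0 < α₀ → (geo i).M * α₀ ≤ a₁ →
      ∀ U : (bg i).Cfg, (bg i).Reg335 c35 α₀ U → (bg i).Reg336 c35 α₀ U →
        Letters313DZ (𝔬 i) (R₀ i) (H₀ i) (hgeo i) (wZ i) (hwZ i) B₃ δ₃ (bH i U) U ∧
          Letters313DMZ (𝔬 i) (𝔭 i) (Dd i) (R₀ i) (H₀ i) (hgeo i) (wZ i) (hwZ i) B₃ Bq δ₃ (bH i U) U)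
    (hG0C : ∀ i, M₁ ≤ (geo i).M → ∀ α₀ : ℝ, 0 < α₀ → (geo i).M * α₀ ≤ a₁ →
      ∀ U : (bg i).Cfg, (bg i).Reg335 c35 α₀ U → (bg i).Reg336 c35 α₀ U →
        Thm33G0Dir (𝔬 i) (𝔭 i) (Dd i) (Dds i) (R₀ i) (H₀ i) (bHX i) B₀ Bh Bi Bi2 δ₀ U ∧
          Thm33G0DirR (𝔬 i) (Dds i) (R₀ i) (H₀ i) B₀ δ₀ U)
    (hLHH : ∀ i, M₁ ≤ (geo i).M → ∀ α₀ : ℝ, 0 < α₀ → (geo i).M * α₀ ≤ a₁ →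
      ∀ U : (bg i).Cfg, (bg i).Reg335 c35 α₀ U → (bg i).Reg336 c35 α₀ U →
        LettersHHZ (𝔬 i) (𝔭 i) (R₀ i) (H₀ i) (hgeo i).lenle
          (weightNorm (BlockNorm.ofBlocks (toB6 (geo i) (R₀ i) (H₀ i)) (𝔬 i).blkZ) (wZ i) fun y => (hwZ i y).le) Bq δ₃ U)
    (hLH3 : ∀ i, M₁ ≤ (geo i).M → ∀ α₀ : ℝ, 0 < α₀ → (geo i).M * α₀ ≤ a₁ →
      ∀ U : (bg i).Cfg, (bg i).Reg335 c35 α₀ U → (bg i).Reg336 c35 α₀ U →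
        Letters313HZc (𝔬 i) (𝔭 i) (Gp i) (R₀ i) (H₀ i) (hgeo i) (wZ i) (hwZ i) (bH i U) BhD Bx δ₃ (bXH i U) U)
    (hG0L2 : ∀ i, M₁ ≤ (geo i).M → ∀ α₀ : ℝ, 0 < α₀ → (geo i).M * α₀ ≤ a₁ →
      ∀ U : (bg i).Cfg, (bg i).Reg335 c35 α₀ U → (bg i).Reg336 c35 α₀ U →
        Thm33G0L2M (𝔬 i) (Dd i) (Dds i) (R₀ i) (H₀ i) B₂ δ₀ U)
    (hstepL2 : ∀ i, M₁ ≤ (geo i).M → ∀ α₀ : ℝ, 0 < α₀ → (geo i).M * α₀ ≤ a₁ →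
      ∀ U : (bg i).Cfg, (bg i).Reg335 c35 α₀ U → (bg i).Reg336 c35 α₀ U →
        StepL2 (𝔬 i) (R₀ i) (H₀ i) (θ₂ * ((geo i).M * α₀)) δK U)
    (vZ : ∀ i, (geo i).Site → ℝ) (hvZ : ∀ i y, 0 < vZ i y)
    -- the block-L² pair record WITHOUT its `c1` field: the pair letters AS A FUNCTION OF the `c1` field, monotone in the letters (B′ ≧ B₄, δ′ ≦ δ₃); the direction letters as before
    (hLL2 : ∀ i, M₁ ≤ (geo i).M → ∀ α₀ : ℝ, 0 < α₀ → (geo i).M * α₀ ≤ a₁ →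
      ∀ U : (bg i).Cfg, (bg i).Reg335 c35 α₀ U → (bg i).Reg336 c35 α₀ U →
        (∀ B' δ' : ℝ, B₄ ≤ B' → δ' ≤ δ₃ →
          BlockBd (g := toB6 (geo i) (R₀ i) (H₀ i)) (𝔬 i).blkZ (𝔬 i).blkZ ((𝔬 i).C1 U)
            (fun (y y' : (geo i).Site) => B' * (vZ i y * (geo i).len y)⁻¹ * (vZ i y' * (geo i).len y')⁻¹ * Real.exp (-(δ' * (geo i).dist y y'))) →
          Letters313L2Pc (𝔬 i) (Dd i) (Dds i) (R₀ i) (H₀ i) B' δ' (vZ i) (hvZ i) U) ∧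
          Letters313L2MZ (𝔬 i) (Dd i) (Dds i) (R₀ i) (H₀ i) B₄ δ₃ (vZ i) (hvZ i) U)
    -- the `c1` field ((3.46) for C₁ = (QG₁Q\*)⁻¹ in block L²) at ITS OWN letters (BC, δC): in a consumer, the rate of the DERIVED (3.132) letter
    (hc1L2 : ∀ i, M₁ ≤ (geo i).M → ∀ α₀ : ℝ, 0 < α₀ → (geo i).M * α₀ ≤ a₁ →
      ∀ U : (bg i).Cfg, (bg i).Reg335 c35 α₀ U → (bg i).Reg336 c35 α₀ U →
        BlockBd (g := toB6 (geo i) (R₀ i) (H₀ i)) (𝔬 i).blkZ (𝔬 i).blkZ ((𝔬 i).C1 U)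
          (fun (y y' : (geo i).Site) => BC * (vZ i y * (geo i).len y)⁻¹ * (vZ i y' * (geo i).len y')⁻¹ * Real.exp (-(δC * (geo i).dist y y'))))
    (hrgdd : ∀ i, M₁ ≤ (geo i).M → ∀ α₀ : ℝ, 0 < α₀ → (geo i).M * α₀ ≤ a₁ →
      ∀ U : (bg i).Cfg, (bg i).Reg335 c35 α₀ U → (bg i).Reg336 c35 α₀ U →
        ∀ (μ : P) (ε : ℝ), 0 < ε → HasMaj (bHX i ε) (bHW i U ε) ((𝔬 i).R U ∘ₗ (𝔬 i).Dvstar U ∘ₗ (𝔬 i).G1 U ∘ₗ Dds i U μ)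
          (fun a b => Br ε * Real.exp (-(δ₃ * (geo i).dist a b))))
    (hdgDvd : ∀ i, M₁ ≤ (geo i).M → ∀ α₀ : ℝ, 0 < α₀ → (geo i).M * α₀ ≤ a₁ →
      ∀ U : (bg i).Cfg, (bg i).Reg335 c35 α₀ U → (bg i).Reg336 c35 α₀ U →
        ∀ (ν : P) (ε : ℝ), 0 < ε → ε ≤ 1 → HasMaj (bHW i U ε) (BlockNorm.ofBlocks (toB6 (geo i) (R₀ i) (H₀ i)) (𝔬 i).blk)
          (Dd i U ν ∘ₗ ((𝔬 i).G0 U ∘ₗ (𝔬 i).Dv U)) (fun (a b : (geo i).Site) => Bd ε * Real.exp (-(δ₃ * (geo i).dist a b))))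
    (hpdgDvd : ∀ i, M₁ ≤ (geo i).M → ∀ α₀ : ℝ, 0 < α₀ → (geo i).M * α₀ ≤ a₁ →
      ∀ U : (bg i).Cfg, (bg i).Reg335 c35 α₀ U → (bg i).Reg336 c35 α₀ U →
        ∀ (ν : P) (ε β : ℝ), 0 < ε → ε ≤ 1 → 0 ≤ β → β < 1 →
          HasMaj (bHW i U (β + ε)) (BlockNorm.ofBlocks (toB6 (geo i) (R₀ i) (H₀ i)) (𝔭 i).blkPX)
            (((𝔭 i).ΦX U β ∘ₗ Dd i U ν) ∘ₗ ((𝔬 i).G0 U ∘ₗ (𝔬 i).Dv U))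
            (fun (a b : (geo i).Site) => Bd2 ε β * (geo i).len a ^ (-β) * Real.exp (-(δ₃ * (geo i).dist a b))))
    (hdomX : ∀ (i : I) (ε : ℝ), 0 < ε → ∃ ΛX : ℝ, 0 ≤ ΛX ∧
      ∀ (y : (geo i).Site) (μ : X i → ℝ), (bHX i ε).IsLoc y μ → ∑ q : X i, |μ q| ≤ ΛX * (bHX i ε).loc y μ)
    (hdomW : ∀ (i : I) (U : (bg i).Cfg) (ε : ℝ), 0 < ε → ∃ ΛW : ℝ, 0 ≤ ΛW ∧
      ∀ (y : (geo i).Site) (μ : W i → ℝ), (bHW i U ε).IsLoc y μ → ∑ w : W i, |μ w| ≤ ΛW * (bHW i U ε).loc y μ)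
    (hstate2 : ∀ i, M₁ ≤ (geo i).M → ∀ α₀ : ℝ, 0 < α₀ → (geo i).M * α₀ ≤ a₁ →
      ∀ U : (bg i).Cfg, (bg i).Reg335 c35 α₀ U → (bg i).Reg336 c35 α₀ U →
        StepS (𝔬 i) (𝔖₂ i U) (θS * ((geo i).M * α₀)) δK U ∧
        HasMaj (𝔖₂ i U) (cNorm (R₀ i) (H₀ i) (𝔬 i).blkY (hgeo i).lenle 1) ((𝔬 i).D U ∘ₗ (𝔬 i).G0 U ∘ₗ ((𝔬 i).Tpi U + (𝔬 i).T2 U))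
          (fun a b => θD * ((geo i).M * α₀) * Real.exp (-(δK * (geo i).dist a b))) ∧
        (∀ ν : P, HasMaj (𝔖₂ i U) (cNorm (R₀ i) (H₀ i) (𝔬 i).blk (hgeo i).lenle 1) (Dd i U ν ∘ₗ (𝔬 i).G0 U ∘ₗ ((𝔬 i).Tpi U + (𝔬 i).T2 U))
          (fun a b => θD * ((geo i).M * α₀) * Real.exp (-(δK * (geo i).dist a b)))) ∧
        (∀ β : ℝ, 0 ≤ β → β < 1 → HasMaj (𝔖₂ i U) (cNormR (R₀ i) (H₀ i) (𝔭 i).blkPY (hgeo i).lenle (β - 1))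
          (((𝔭 i).ΦY U β ∘ₗ (𝔬 i).D U ∘ₗ (𝔬 i).G0 U) ∘ₗ ((𝔬 i).Tpi U + (𝔬 i).T2 U))
          (fun a b => θH β * ((geo i).M * α₀) * Real.exp (-(δK * (geo i).dist a b)))) ∧
        (∀ (ν : P) (β : ℝ), 0 ≤ β → β < 1 → HasMaj (𝔖₂ i U) (cNormR (R₀ i) (H₀ i) (𝔭 i).blkPX (hgeo i).lenle (β - 1))
          (((𝔭 i).ΦX U β ∘ₗ Dd i U ν ∘ₗ (𝔬 i).G0 U) ∘ₗ ((𝔬 i).Tpi U + (𝔬 i).T2 U))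
          (fun a b => θH β * ((geo i).M * α₀) * Real.exp (-(δK * (geo i).dist a b)))) ∧
        HasMaj (cNorm (R₀ i) (H₀ i) (𝔬 i).blk (hgeo i).lenle 0) (𝔖₂ i U) ((𝔬 i).G0 U)
          (fun a b => A₀ * Real.exp (-(δP * (geo i).dist a b))) ∧
        HasMaj (cNorm (R₀ i) (H₀ i) (𝔬 i).blkW (hgeo i).lenle 1) (𝔖₂ i U) ((𝔬 i).G0 U ∘ₗ (𝔬 i).Dv U)
          (fun a b => AW * Real.exp (-(δP * (geo i).dist a b))) ∧
        HasMaj (weightNorm (BlockNorm.ofBlocks (toB6 (geo i) (R₀ i) (H₀ i)) (𝔬 i).blkZ) (wZ i) fun y => (hwZ i y).le) (𝔖₂ i U)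
          ((𝔬 i).G0 U ∘ₗ (𝔬 i).Qstar U) (fun a b => AQ * Real.exp (-(δP * (geo i).dist a b))) ∧
        HasMaj (𝔖₂ i U) (cNormR (R₀ i) (H₀ i) (𝔬 i).blk (hgeo i).lenle (-2)) LinearMap.id
          (fun a b => CR * Real.exp (-(δP * (geo i).dist a b))) ∧
        (∃ Λ : ℝ, 0 ≤ Λ ∧ ∀ (y : (geo i).Site) (F : X i → ℝ), (𝔖₂ i U).loc y F ≤ Λ * ∑ x : X i, |F x|))
    (hstate1 : ∀ i, M₁ ≤ (geo i).M → ∀ α₀ : ℝ, 0 < α₀ → (geo i).M * α₀ ≤ a₁ →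
      ∀ U : (bg i).Cfg, (bg i).Reg335 c35 α₀ U → (bg i).Reg336 c35 α₀ U →
        StepS (𝔬 i) (𝔖₁ i U) (θS * ((geo i).M * α₀)) δK U ∧
        (∀ ν : P, HasMaj (𝔖₁ i U) (cNormR (R₀ i) (H₀ i) (𝔬 i).blk (hgeo i).lenle 0) (Dd i U ν ∘ₗ (𝔬 i).G0 U ∘ₗ ((𝔬 i).Tpi U + (𝔬 i).T2 U))
          (fun a b => θD * ((geo i).M * α₀) * Real.exp (-(δK * (geo i).dist a b)))) ∧
        (∀ β : ℝ, 0 ≤ β → β < 1 → HasMaj (𝔖₁ i U) (cNormR (R₀ i) (H₀ i) (𝔭 i).blkPX (hgeo i).lenle (β - 1))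
          (((𝔭 i).ΦX U β ∘ₗ (𝔬 i).G0 U) ∘ₗ ((𝔬 i).Tpi U + (𝔬 i).T2 U))
          (fun a b => θH β * ((geo i).M * α₀) * Real.exp (-(δK * (geo i).dist a b)))) ∧
        (∀ (ν : P) (β : ℝ), 0 ≤ β → β < 1 → HasMaj (𝔖₁ i U) (cNormR (R₀ i) (H₀ i) (𝔭 i).blkPX (hgeo i).lenle β)
          (((𝔭 i).ΦX U β ∘ₗ Dd i U ν ∘ₗ (𝔬 i).G0 U) ∘ₗ ((𝔬 i).Tpi U + (𝔬 i).T2 U))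
          (fun a b => θH β * ((geo i).M * α₀) * Real.exp (-(δK * (geo i).dist a b)))) ∧
        HasMaj (cNormR (R₀ i) (H₀ i) (𝔬 i).blkY (hgeo i).lenle 0) (𝔖₁ i U) ((𝔬 i).G0 U ∘ₗ (𝔬 i).Dstar U)
          (fun a b => AD * Real.exp (-(δP * (geo i).dist a b))) ∧
        (∀ (μ : P) (ε : ℝ), 0 < ε → HasMaj (bHX i ε) (𝔖₁ i U) ((𝔬 i).G0 U ∘ₗ Dds i U μ)
          (fun a b => AI ε * Real.exp (-(δP * (geo i).dist a b)))) ∧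
        (∀ ε : ℝ, 0 < ε → HasMaj (bHW i U ε) (𝔖₁ i U) ((𝔬 i).G0 U ∘ₗ (𝔬 i).Dv U)
          (fun a b => AV ε * Real.exp (-(δP * (geo i).dist a b)))) ∧
        HasMaj (weightNorm (BlockNorm.ofBlocks (toB6 (geo i) (R₀ i) (H₀ i)) (𝔬 i).blkZ) (fun y => (geo i).len y * wZ i y)
            fun y => (wZlen_pos (hgeo i) (hwZ i) y).le) (𝔖₁ i U)
          ((𝔬 i).G0 U ∘ₗ (𝔬 i).Qstar U) (fun a b => AQ1 * Real.exp (-(δP * (geo i).dist a b))) ∧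
        HasMaj (𝔖₁ i U) (cNormR (R₀ i) (H₀ i) (𝔬 i).blk (hgeo i).lenle (-1)) LinearMap.id
          (fun a b => CR₁ * Real.exp (-(δP * (geo i).dist a b))) ∧
        (∃ Λ : ℝ, 0 ≤ Λ ∧ ∀ (y : (geo i).Site) (F : X i → ℝ), (𝔖₁ i U).loc y F ≤ Λ * ∑ x : X i, |F x|)) :
    B9.Thm313Printed c35 geo bg GG (fun i => HasRWExpOfOps (𝔬 i)) (fun i => PosDefKOfOps (𝔬 i)) := by
  -- the leaf at the cut constant `max B₄ BC` and at its own master rate ρ as the letters' common rate (it weakens every δ₃-letter to ρ inside anyway):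
  -- every δ₃-family weakened to ρ (`kernel_mono` ∕ the records' `_mono` lemmas, as in the leaf's own proof), the `c1` field from (BC, δC) to (max B₄ BC, ρ)
  -- and handed to `hLL2`.1, the direction letters to (max B₄ BC, ρ) by `letters313L2MZ_monoB`
  have hB₄' : 0 ≤ max B₄ BC := le_max_of_le_left hB₄
  exact thm313Printed_completePairMBCZcUSXC 𝔬 R₀ H₀ GG bH 𝔭 bHX Gp bXH Dd Dds bHW 𝔖₂ 𝔖₁ ev evY Rel m mN r Cev CL θS θD θ₂ r₁ B₀ B₂ (max B₄ BC) δ₀ δK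
    δP σ c ρ a₁ M₁ ML B₃ ρ δC ρ' α Lc κ₀ κS A₀ AW AQ AD AQ1 CR CR₁ Bh Bi Bq BhD Bx Bd θH Br AI AV Bi2 Bd2 hθS hθD hθH hθ₂ hκS hA₀ hAW hAQ hAD hAQ1 hCR
    hCR₁ hAI hAV hr₁ hB₀ hB₂ hB₃ hB₄' hBr hσ hρ' hρ'ρ hρ'ρ₅ hσρ' hρS le_rfl hρC hρδ hρP hc ha₁ hM₁ hα0 hBi hBd hBi2 hBd2 hBh hBq hBhD hBx hCev hCL1
    hgeo S hL1 hLle hη hκ hκW hκX hκ2 hκ1 hSX hADB hrow hL21 hnbr hCL hsat hmult hcoR hco1R hcoG hsymGG hl2N hH1N hIF hRdist hmodel he1 wZ hwZ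
    (fun i hM α₀ hα ha U hU hU' =>
      have z := hZ8 i hM α₀ hα ha U hU hU'
      have kB := fun (a b : (geo i).Site) => kernel_mono (hgeo i) hB₃ (le_refl B₃) hρ₃ a b
      ⟨z.1.mono kB, z.2.1.mono kB, z.2.2.1.mono kB, z.2.2.2.1.mono kB, z.2.2.2.2.1, z.2.2.2.2.2.1, z.2.2.2.2.2.2.1.mono kB, z.2.2.2.2.2.2.2.mono kB⟩)
    (fun i hM α₀ hα ha U hU hU' => (hwGp i hM α₀ hα ha U hU hU').mono fun a b => kernel_mono (hgeo i) hB₃ (le_refl B₃) hρ₃ a b) h152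
    (fun i hM α₀ hα ha U hU hU' =>
      ⟨letters313DZ_mono (hgeo i) hB₃ le_rfl hρ₃ (hlettersD i hM α₀ hα ha U hU hU').1,
        letters313DMZ_mono (hgeo i) hB₃ le_rfl hBq (fun β _ _ => le_refl (Bq β)) hρ₃ (hlettersD i hM α₀ hα ha U hU hU').2⟩)
    hG0C (fun i hM α₀ hα ha U hU hU' => lettersHHZ_mono (hgeo i) hBq (fun β _ _ => le_refl (Bq β)) hρ₃ (hLHH i hM α₀ hα ha U hU hU'))
    (fun i hM α₀ hα ha U hU hU' =>
      have hH3 := hLH3 i hM α₀ hα ha U hU hU'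
      ⟨fun β h0 h1 => (hH3.pYDH β h0 h1).mono (kernel_mono (hgeo i) (hBhD β h0 h1) le_rfl hρ₃),
        fun β h0 h1 => (hH3.pXQs β h0 h1).mono (kernel_mono (hgeo i) (hBx β h0 h1) le_rfl hρ₃),
        fun β h0 h1 => (hH3.pWE β h0 h1).mono (kernel_mono (hgeo i) (hBx β h0 h1) le_rfl hρ₃)⟩)
    hG0L2 hstepL2 vZ hvZ
    (fun i hM α₀ hα ha U hU hU' =>
      have hvl : ∀ y : (geo i).Site, 0 ≤ (vZ i y * (geo i).len y)⁻¹ := fun y => inv_nonneg.mpr (mul_pos (hvZ i y) ((hgeo i).lenpos y)).le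
      ⟨(hLL2 i hM α₀ hα ha U hU hU').1 (max B₄ BC) ρ (le_max_left _ _) hρ₃
          ((hc1L2 i hM α₀ hα ha U hU hU').mono fun y y' =>
            mul_le_mul (mul_le_mul_of_nonneg_right (mul_le_mul_of_nonneg_right (le_max_right B₄ BC) (hvl y)) (hvl y'))
              (Real.exp_le_exp.mpr (neg_le_neg (mul_le_mul_of_nonneg_right hρC ((hgeo i).dnn y y')))) (Real.exp_nonneg _)
              (mul_nonneg (mul_nonneg hB₄' (hvl y)) (hvl y'))),
        letters313L2MZ_monoB (hgeo i) hB₄ (le_max_left B₄ BC) hρ₃ (hLL2 i hM α₀ hα ha U hU hU').2⟩)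
    (fun i hM α₀ hα ha U hU hU' μ ε hε => (hrgdd i hM α₀ hα ha U hU hU' μ ε hε).mono (kernel_mono (hgeo i) (hBr ε hε) le_rfl hρ₃))
    (fun i hM α₀ hα ha U hU hU' ν ε h0 h1 => (hdgDvd i hM α₀ hα ha U hU hU' ν ε h0 h1).mono (kernel_mono (hgeo i) (hBd ε h0 h1) le_rfl hρ₃))
    (fun i hM α₀ hα ha U hU hU' ν ε β h0 h1 hb0 hb1 => (hpdgDvd i hM α₀ hα ha U hU hU' ν ε β h0 h1 hb0 hb1).mono fun a b =>
      mul_le_mul_of_nonneg_left (Real.exp_le_exp.mpr (neg_le_neg (mul_le_mul_of_nonneg_right hρ₃ ((hgeo i).dnn a b))))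
        (mul_nonneg (hBd2 ε β h0 h1 hb0 hb1) (Real.rpow_nonneg ((hgeo i).lenle a) _)))
    hdomX hdomW hstate2 hstate1

end Family

end

end Literature.MathematicalPhysics.QuantumFieldTheory.Balaban1983to89.B9Thm313WholeLeafCompletePairMBCZcUSXCL
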